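import Summits.MatrixMultiplication.OmegaCensus.DicyclicLawTwoGroupQuotient
import Summits.MatrixMultiplication.OmegaCensus.C2C2QuaternionLaw
import Summits.MatrixMultiplication.OmegaCensus.DihedralLikeLawGap12
import Mathlib.GroupTheory.SpecificGroups.Quaternion
import HarnessLib

/-!
# `C₂² × Q_{4m}`, `m = 2^k`: the dicyclic law `(64m − 16)/3` is not attained; `β(C₂² × Q_{4m}) ≤ (64m − 28)/3` for `m = 4^j ≥ 16`

ω-census `pub-omega`, family (b3), seat pub-omega-group gen 12.  Framing: lottery ticket; floor = certified bounds/negative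
ranges.  VALUE: kernel census clauses (group-theoretic method); NOT progress on ω.

`C₂² × Q_{4m} = G(ℤ₂ × ℤ₂ × ℤ_{2m}, (0,0,m))`; for `m = 2^k` (`k ≥ 3`) the quotient `A/⟨c₀⟩ = ℤ₂² × ℤ_m` is a `2`-group of
`2`-rank `3` (`π = (id, id, reduction mod m)`, the three characters `x`, `y`, `z mod 2`), so `no_dicyclic_law_of_two_group_quot`
applies (`|A| = 8m ≥ 64`):

* `c2c2_quaternion_no_dicyclic_law_two_pow`: **no TPP triple of `C₂² × Q_{2^{k+2}}` (`k ≥ 3`) attains `3|S||T||U| + 16 = 64·2^k`**;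
* `c2c2_quaternion_two_pow_le`: for `m = 2^k ≡ 4 (mod 6)` (`m = 16, 64, 256, …`), **`3|S||T||U| + 28 ≤ 64m`**, i.e.
  `β(C₂² × Q_{4m}) ≤ (64m − 28)/3` — the window `[(64m−64)/3, (64m−16)/3]` of `c2c2_quaternion_window_mod_six_four` shrinks to
  `[(64m−64)/3, (64m−28)/3]` by the mod-12 gap (`tpp_volume_mod_two_gap12`).  E.g. `β(C₂² × Q₆₄) ∈ [320, 332]` (law `336` excluded).
The smallest member `m = 4` (`|A| = 32 < 50`) is the certified value `β(C₂² × Q₁₆) = 64` (NR-row, enumeration ∥ SAT).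
-/

namespace Summit.MatrixMultiplication.OmegaCensus

open Literature.Combinatorics.Additive Finset

section C2C2QTwoPow

variable {m : ℕ} [NeZero m]

/-- Reduction `ℤ_{2m} → ℤ_m` vanishes exactly on `{0, m}`. [folklore] -/
theorem zmod_castHom_two_mul_eq_zero_iff [NeZero (2 * m)] (z : ZMod (2 * m)) :
    ZMod.castHom (dvd_mul_left m 2) (ZMod m) z = 0 ↔ z = 0 ∨ z = (m : ZMod (2 * m)) := by
  have hm0 : 0 < m := Nat.pos_of_ne_zero (NeZero.ne m)
  constructor
  · intro h
    rw [ZMod.castHom_apply, ZMod.cast_eq_val, ZMod.natCast_eq_zero_iff] at h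
    obtain ⟨c, hc⟩ := h
    have hlt : z.val < 2 * m := ZMod.val_lt z
    have hc2 : c < 2 := by
      by_contra hge
      have : 2 * m ≤ m * c := by nlinarith
      omega
    interval_cases c
    · left; exact (ZMod.val_eq_zero z).1 (by rw [hc, mul_zero])
    · right; rw [← ZMod.natCast_zmod_val z, hc, mul_one]
  · rintro (rfl | rfl)
    · exact map_zero _
    · rw [map_natCast, ZMod.natCast_self]

/-- **`C₂² × Q_{4m}`, `m = 2^k` (`k ≥ 3`): the dicyclic law is not attained.**  For every TPP triple `(S,T,U)` of
`C₂² × Q_{4m}`: `3|S||T||U| + 16 ≠ 64m`. [folklore] -/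
theorem c2c2_quaternion_no_dicyclic_law_two_pow (k : ℕ) (hk : 3 ≤ k) (hm : m = 2 ^ k)
    {S T U : Finset (Multiplicative (ZMod 2) × (Multiplicative (ZMod 2) × QuaternionGroup m))}
    (h : TripleProductProperty S T U) : 3 * (S.card * T.card * U.card) + 16 ≠ 64 * m := by
  have hm8 : 8 ≤ m := by
    rw [hm]; calc 8 = 2 ^ 3 := by norm_num
      _ ≤ 2 ^ k := Nat.pow_le_pow_right (by norm_num) hk
  haveI : NeZero (2 * m) := ⟨by omega⟩
  obtain ⟨hc₀', -⟩ := z2_z2_z2m_quot_noncyclic (m := m)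
  refine c2_quaternion_presentation (m := m) fun ρ τ c₀ hρρ hρτ hτρ hττ hρ hτ hne hsurj hc => ?_
  subst hc
  refine c2_product_presentation hρρ hρτ hτρ hττ hρ hτ hne hsurj
    fun ρ' τ' c₀' hρρ' hρτ' hτρ' hττ' hρ' hτ' hne' hsurj' hc' => ?_
  subst hc'
  have hcard : Fintype.card (ZMod 2 × (ZMod 2 × ZMod (2 * m))) = 8 * m := by
    rw [Fintype.card_prod, Fintype.card_prod, ZMod.card, ZMod.card]; ring
  -- the three characters `x`, `y`, `z mod 2`
  have h2m : 2 ∣ m := ⟨2 ^ (k - 1), by rw [hm, ← pow_succ']; congr 1; omega⟩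
  let ψ₁ : ZMod 2 × (ZMod 2 × ZMod (2 * m)) →+ ZMod 2 := AddMonoidHom.fst _ _
  let ψ₂ : ZMod 2 × (ZMod 2 × ZMod (2 * m)) →+ ZMod 2 := (AddMonoidHom.fst _ _).comp (AddMonoidHom.snd _ _)
  let ψ₃ : ZMod 2 × (ZMod 2 × ZMod (2 * m)) →+ ZMod 2 :=
    (ZMod.castHom (show 2 ∣ 2 * m from dvd_mul_right 2 m) (ZMod 2)).toAddMonoidHom.comp
      ((AddMonoidHom.snd _ _).comp (AddMonoidHom.snd _ _))
  have hψ₃ : ∀ p : ZMod 2 × (ZMod 2 × ZMod (2 * m)),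
      ψ₃ p = ZMod.castHom (show 2 ∣ 2 * m from dvd_mul_right 2 m) (ZMod 2) p.2.2 := fun p => rfl
  have hψc : ψ₁ (0, (0, (m : ZMod (2 * m)))) = 0 ∧ ψ₂ (0, (0, (m : ZMod (2 * m)))) = 0 ∧
      ψ₃ (0, (0, (m : ZMod (2 * m)))) = 0 := by
    refine ⟨rfl, rfl, ?_⟩
    rw [hψ₃]
    show ZMod.castHom _ (ZMod 2) ((m : ℕ) : ZMod (2 * m)) = 0
    rw [map_natCast]; exact (ZMod.natCast_eq_zero_iff m 2).2 h2m
  have hψ : ∀ v : ZMod 2 × ZMod 2 × ZMod 2, ∃ x, (ψ₁ x, ψ₂ x, ψ₃ x) = v := by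
    rintro ⟨v₁, v₂, v₃⟩
    refine ⟨(v₁, (v₂, ((v₃.val : ℕ) : ZMod (2 * m)))), ?_⟩
    simp only [Prod.mk.injEq]
    refine ⟨rfl, rfl, ?_⟩
    rw [hψ₃]
    show ZMod.castHom _ (ZMod 2) ((v₃.val : ℕ) : ZMod (2 * m)) = v₃
    rw [map_natCast, ZMod.natCast_zmod_val]
  -- the quotient map `π = (id, id, mod m)` onto the `2`-group `ℤ₂ × ℤ₂ × ℤ_m`
  let π : ZMod 2 × (ZMod 2 × ZMod (2 * m)) →+ ZMod 2 × (ZMod 2 × ZMod m) :=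
    (AddMonoidHom.fst _ _).prod (((AddMonoidHom.fst _ _).comp (AddMonoidHom.snd _ _)).prod
      ((ZMod.castHom (dvd_mul_left m 2) (ZMod m)).toAddMonoidHom.comp
        ((AddMonoidHom.snd _ _).comp (AddMonoidHom.snd _ _))))
  have hπ : ∀ p : ZMod 2 × (ZMod 2 × ZMod (2 * m)),
      π p = (p.1, (p.2.1, ZMod.castHom (dvd_mul_left m 2) (ZMod m) p.2.2)) := fun p => rfl
  have hker : ∀ a, π a = 0 ↔ a = 0 ∨ a = (0, (0, (m : ZMod (2 * m)))) := by
    intro a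
    rw [hπ, Prod.mk_eq_zero, Prod.mk_eq_zero, zmod_castHom_two_mul_eq_zero_iff]
    constructor
    · rintro ⟨h1, h2, h3 | h3⟩
      · left; exact Prod.ext h1 (Prod.ext h2 h3)
      · right; exact Prod.ext h1 (Prod.ext h2 h3)
    · rintro (rfl | rfl)
      · exact ⟨rfl, rfl, Or.inl rfl⟩
      · exact ⟨rfl, rfl, Or.inr rfl⟩
  have hπs : Function.Surjective π := by
    rintro ⟨x, y, w⟩
    refine ⟨(x, (y, ((w.val : ℕ) : ZMod (2 * m)))), ?_⟩
    rw [hπ]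
    simp only
    rw [map_natCast, ZMod.natCast_zmod_val]
  have hB : ∀ b : ZMod 2 × (ZMod 2 × ZMod m), (2 ^ k) • b = 0 := by
    rintro ⟨x, y, w⟩
    have h2 : ((2 ^ k : ℕ) : ZMod 2) = 0 :=
      (ZMod.natCast_eq_zero_iff _ 2).2 ⟨2 ^ (k - 1), by rw [← pow_succ']; congr 1; omega⟩
    have hw : ((2 ^ k : ℕ) : ZMod m) = 0 := by rw [← hm]; exact ZMod.natCast_self m
    refine Prod.ext ?_ (Prod.ext ?_ ?_)
    · show (2 ^ k) • x = 0; rw [nsmul_eq_mul, h2, zero_mul]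
    · show (2 ^ k) • y = 0; rw [nsmul_eq_mul, h2, zero_mul]
    · show (2 ^ k) • w = 0; rw [nsmul_eq_mul, hw, zero_mul]
  have key := no_dicyclic_law_of_two_group_quot hρρ' hρτ' hτρ' hττ' hc₀' hρ' hτ' hne' hsurj' (by rw [hcard]; omega)
    ψ₁ ψ₂ ψ₃ hψc hψ π hπs hker hB h
  rwa [hcard, show 8 * (8 * m) = 64 * m by ring] at key

/-- **`β(C₂² × Q_{4m}) ≤ (64m − 28)/3` for `m = 2^k ≡ 4 (mod 6)`** (`m = 16, 64, 256, …`): for every TPP triple,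
`3|S||T||U| + 28 ≤ 64m` (window theorem + `c2c2_quaternion_no_dicyclic_law_two_pow` + the mod-12 gap). [folklore] -/
theorem c2c2_quaternion_two_pow_le (k : ℕ) (hk : 3 ≤ k) (hm : m = 2 ^ k) (h4 : m % 6 = 4)
    {S T U : Finset (Multiplicative (ZMod 2) × (Multiplicative (ZMod 2) × QuaternionGroup m))}
    (h : TripleProductProperty S T U) : 3 * (S.card * T.card * U.card) + 28 ≤ 64 * m := by
  have hm8 : 8 ≤ m := by
    rw [hm]; calc 8 = 2 ^ 3 := by norm_num
      _ ≤ 2 ^ k := Nat.pow_le_pow_right (by norm_num) hk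
  haveI : NeZero (2 * m) := ⟨by omega⟩
  have hne16 := c2c2_quaternion_no_dicyclic_law_two_pow k hk hm h
  obtain ⟨hwin, -⟩ := c2c2_quaternion_window_mod_six_four (m := m) h4
  have h16 := hwin S T U h
  -- the mod-12 gap in the abstract presentation
  have hgap : 3 * (S.card * T.card * U.card) + 4 = 8 * (8 * m) ∨ 3 * (S.card * T.card * U.card) + 16 = 8 * (8 * m) ∨
      3 * (S.card * T.card * U.card) + 28 = 8 * (8 * m) ∨ 3 * (S.card * T.card * U.card) + 32 ≤ 8 * (8 * m) := by
    refine c2_quaternion_presentation (m := m) fun ρ τ c₀ hρρ hρτ hτρ hττ hρ hτ hne hsurj hc => ?_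
    refine c2_product_presentation hρρ hρτ hτρ hττ hρ hτ hne hsurj
      fun ρ' τ' c₀' hρρ' hρτ' hτρ' hττ' hρ' hτ' hne' hsurj' hc' => ?_
    have hcard : Fintype.card (ZMod 2 × (ZMod 2 × ZMod (2 * m))) = 8 * m := by
      rw [Fintype.card_prod, Fintype.card_prod, ZMod.card, ZMod.card]; ring
    have key := tpp_volume_mod_two_gap12 hρρ' hρτ' hτρ' hττ' hρ' hτ' hne' hsurj' (by rw [hcard]; omega)
      (by rw [hcard]; omega) h
    rwa [hcard] at key
  omega

end C2C2QTwoPow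

end Summit.MatrixMultiplication.OmegaCensus
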